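import Summits.HodgeConjecture.HodgeConjecture.Theorems.HeckePrymWeilWeilFamilyAnchorPackage
import Summits.HodgeConjecture.HodgeConjecture.Theorems.HeckePrymWeilSemiregularSpreadOfBlochLifts
import HarnessLib

/-!
# The `ℚ(√-p)` Hodge–Weil rungs from a clean, charged, semiregular lci cycle on the tensor anchor, Bloch's OBJECT-level semiregularity theorem and Fulton's specialisation of cycle classes

Route `HeckePrymWeil` (sub-problem `HodgeConjecture`); lead seat c15 of crux `WeilTwelvefoldsSqrtMinus7`
(stmt-HodgeConjecture-1261), line `semiregular-clean-lci-anchor`, reshape r2.  Companion of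
`HeckePrymWeilHodgeWeilOfSemiregularCleanLci` (lead c14, r1): there the transport engine was the monolithic
class-level named fact `BlochSemiregularSpread (2k) k`; here it is REPLACED by the two named facts it follows
from — Bloch's object-level theorem `Bloch1972_semiregularSubschemeLifts` (Bloch 1972 Thm. (7.1) with the proof
of (7.4): a semiregular lci lifts to a flat family over an étale neighbourhood) and Fulton's specialisation of
the cycle class of a flat family `fulton1998_flatFamily_cycleClass_specialises` (Fulton 1998 Cor. 10.1,
Lemma 19.1.1), both SHARED with crux 1076's line `polar-patch-broken-cycles` — through the glue
`semiregularSpread_of_blochLifts_of_fulton` (purity, rigidity of flat sections, open image of the smooth base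
change).  Accordingly the SUPPLY hypothesis `hS` is stated in the input shape of Bloch's fact: the lci clause as
"conormal sheaf finite locally free", the codimension clauses à la Fulton, and the subscheme produced inside ANY
copy `X₀ ≅ Y.X` of the anchor (the proof takes the fibre `𝒳_{s₀}` itself, so no transport of
`IsBlochSemiregular` along an isomorphism is needed).

* `hodgeWeil_of_semiregularCleanLciLifts_of_globalAction` — **`HWA(p, k)` ⟸ Deligne's global action ∧ the
  clean–charged–semiregular supply (Bloch shape) at `(p, k)` ∧ `Bloch1972_semiregularSubschemeLifts` ∧
  `fulton1998_flatFamily_cycleClass_specialises`**; proof verbatim that of the r1 file up to the supply, then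
  the glue instead of `BlochSemiregularSpread`.

CONDITIONAL on the hypotheses spelled out (the global action, the open supply statement, the two named print
facts); no `sorry`, no new definition.  Lead's assessment of the supply at `(7,6)` (crux workfiles
`Lines/semiregular-clean-lci-anchor-stub2-c14.md`, `…-stub2-c15.md`): complete intersections are never clean
charged effective; zero/degeneracy loci of sufficiently twisted direct-sum bundles are never semiregular
(`H¹(N_Z) ≅ H²(End E)`; every summand must be first-order unobstructed along the 15 non-tensor Weil
directions); the residual content is a Weil-deformable charged bundle on the anchor.
-/

noncomputable section

-- every declaration of this problem lives in `Summit.HodgeConjecture.HodgeConjecture.…` (summit = sub-problem)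
set_option linter.dupNamespace false

open CategoryTheory AlgebraicGeometry Limits MonoidalCategory CartesianMonoidalCategory
open Literature.AlgebraicGeometry Literature.AlgebraicGeometry.Motives
  Literature.AlgebraicGeometry.HodgeTheory Literature.AlgebraicTopology.SingularHomology

namespace Summit.HodgeConjecture.HodgeConjecture.Theorems.HeckePrymWeilLine

open Summit.HodgeConjecture.HodgeConjecture.Theses.HeckePrymWeil

/-! ### `HWA(p, k)` from the global action, the supply (Bloch shape), Bloch lifts and Fulton specialises -/

/-- **`HWA(p, k)` from Deligne's family, a clean charged Bloch-semiregular integral lci `k`-cycle on every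
tensor anchor (in the input shape of Bloch's object-level theorem), Bloch's theorem that semiregular lci lift
to flat families over an étale neighbourhood, and Fulton's specialisation of the cycle class of a flat
family.**  For a prime `p ≡ 3 (4)`, `p ≥ 7`, `k ≥ 1`: granted (i) `hGA`, Deligne's family package
`deligne1982_weilFamily_globalAction`; (ii) `hS`, the SUPPLY — on every tensor-type `√-p`-abelian `2k`-fold
`(Y, Ψ)`, for every projective embedding `e` with `K`-symmetric rational hyperplane class (`Ψ^*h = p·h`), every
non-zero rational `(k,k)` class `x₀` of the strong Weil plane and every copy `e' : Y.X ≅ X₀`: an INTEGRAL closed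
`i : Z ↪ X₀` with finite locally free conormal sheaf, all points of codimension `≥ k` and one of codimension
`k`, Bloch-semiregular (`IsBlochSemiregular i (2k) k`), a rational ambient `θ ∈ H^{2k}(ℙᴺ)` and `α ∈ ℚ^×` with
`e'^{-1 *}(α•x₀ + e^*θ)` supported on `Z`; (iii) `hBl : Bloch1972_semiregularSubschemeLifts`; (iv)
`hFu : fulton1998_flatFamily_cycleClass_specialises` — every rational `(k,k)` class of the typed Weil plane of
every `√-p`-abelian `2k`-fold is algebraic.  Proof: as in `hodgeWeil_of_semiregularCleanLci_of_globalAction`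
(zero class; typing upgrade; Deligne's family through `A` with its anchor; one `ℙᵐ` for all fibres and its
`K`-symmetrisation `ε_K`; the supply inside `𝒳_{s₀}`; the corrected global class `W' := α•W + ε_K^*θ`), then
the glue `semiregularSpread_of_blochLifts_of_fulton` spreads algebraicity of `W'` to a neighbourhood of `s₀`,
Baire (`forall_mem_algebraicClasses_of_isOpen_nonempty`) to all of `S(ℂ)`, and at `s₁` one subtracts the
linear-section class, divides by `α` and returns along the chart.
[cite: Bloch1972Semiregularity, Thm. (7.1), proof of Thm. (7.4), Remark (7.5)]
[cite: Fulton1998, §10.1 Cor. 10.1; §19.1 Lemma 19.1.1] [cite: BuchweitzFlenner2003, Thm. 5.2]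
[cite: Deligne1982HodgeCycles, proof of Thm. 4.8, Lemma 4.5] [cite: CharlesSchnell2014Notes, Prop. 11.3.11] -/
theorem hodgeWeil_of_semiregularCleanLciLifts_of_globalAction (hGA : deligne1982_weilFamily_globalAction)
    {p : ℕ} (hp : p.Prime) (hp4 : p % 4 = 3) (hp7 : 7 ≤ p) {k : ℕ} (hk : 1 ≤ k)
    (hS : ∀ (Y : AbelianVariety ℂ) (Ψ : Y ⟶ Y), Y.dim = 2 * k → Ψ ≫ Ψ = -((p : ℤ) • 𝟙 Y) →
      (∃ (A₁ : AbelianVariety ℂ) (f₁ : Y ⟶ A₁.prod A₁) (g₁ : A₁.prod A₁ ⟶ Y) (m : ℕ),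
          A₁.dim = k ∧ 0 < m ∧ f₁ ≫ g₁ = m • 𝟙 Y ∧ Flat f₁.hom.hom.hom.left ∧
          g₁ ≫ Ψ = AbelianVariety.prodLift (AbelianVariety.snd A₁ A₁ ≫ (-((p : ℤ) • 𝟙 A₁)))
            (AbelianVariety.fst A₁ A₁) ≫ g₁) →
      ∀ (e : ProjectiveEmbedding Y.X) (a : complexBetti (projectiveSpace e.n ℂ) 2),
        IsRationalClass a → a ≠ 0 →
        complexBetti.map Ψ.hom.hom.hom 2 (complexBetti.map e.ι 2 a) = (p : ℂ) • complexBetti.map e.ι 2 a →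
      ∀ (x₀ : complexBetti Y.X (2 * k)),
        x₀ ∈ weilClassesOf Y Ψ k p → x₀ ≠ 0 → IsRationalClass x₀ →
        IsOfHodgeType (2 * k) Y.X (2 * k) k k x₀ →
      ∀ (X₀ : SchemeOver ℂ) (e' : Y.X ≅ X₀),
        ∃ (Z : Scheme.{0}) (i : Z ⟶ X₀.left) (θ : complexBetti (projectiveSpace e.n ℂ) (2 * k)) (α : ℚ),
          IsClosedImmersion i ∧ IsFiniteLocallyFree (Deformation.conormalSheaf i) ∧
          AlgebraicGeometry.IsIntegral Z ∧
          (∀ z : Z, ((k : ℕ) : ℕ∞) ≤ Order.coheight (i.base z)) ∧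
          (∃ z : Z, Order.coheight (i.base z) = ((k : ℕ) : ℕ∞)) ∧
          IsBlochSemiregular i (2 * k) k ∧ IsRationalClass θ ∧ α ≠ 0 ∧
          complexBetti.map e'.inv (2 * k) ((α : ℂ) • x₀ + complexBetti.map e.ι (2 * k) θ) ∈
            classesSupportedOn X₀ (Set.range i.base) (2 * k))
    (hBl : Bloch1972_semiregularSubschemeLifts) (hFu : fulton1998_flatFamily_cycleClass_specialises) :
    ∀ (A : AbelianVariety ℂ) (φ : A ⟶ A), A.dim = 2 * k → φ ≫ φ = -((p : ℤ) • 𝟙 A) →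
      ∀ c : complexBetti A.X (2 * k), IsRationalClass c → IsOfHodgeType (2 * k) A.X (2 * k) k k c →
        c ∈ Module.End.eigenspace (complexBetti.map (𝟙 A + φ).hom.hom.hom (2 * k)).hom
              ((1 + Complex.I * (Real.sqrt (p : ℝ) : ℂ)) ^ (2 * k)) ⊔
            Module.End.eigenspace (complexBetti.map (𝟙 A + φ).hom.hom.hom (2 * k)).hom
              ((1 - Complex.I * (Real.sqrt (p : ℝ) : ℂ)) ^ (2 * k)) →
        c ∈ algebraicClasses A.X k := by
  intro A φ hA hφ c hrat hH hW
  -- the zero class is algebraic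
  by_cases hc0 : c = 0
  · rw [hc0]
    exact Submodule.zero_mem _
  -- typing upgrade: `c` lies in the strong Weil plane of `(A, φ)`
  have hcW : c ∈ weilClassesOf A φ k p := stub_upgrade p hp hp4 hp7 k A φ hA hφ hW
  -- Deligne's family THROUGH `A`, with its tensor anchor
  obtain ⟨𝒳, S, f, s₁, s₀, e, W, Y, Ψ, e₀, g, hfam, hemb, hirr, hsm, hSqp, hg, he₀g, hfibre, hW₁, hY, hΨ,
    htensor, hx₀, hx₀ne⟩ :=
    weilFamily_anchorPackage_of_globalAction hGA hp hp4 hp7 hk A φ hA hφ c hcW hc0 hrat hH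
  haveI := hirr
  haveI := hsm
  -- quasi-projectivity of the total space
  have h𝒳qp : IsQuasiProjectiveOver 𝒳 := by
    obtain ⟨N, ι, hι, -⟩ := hemb
    haveI := hι
    exact IsQuasiProjectiveOver.of_isClosedImmersion_projectiveSpace_tensor ι hSqp
  -- one projective space for all fibres …
  obtain ⟨mN, ε, hε⟩ := exists_forall_isClosedImmersion_fiberι_comp f hfam hemb hSqp
  have hmN : 1 ≤ mN := by
    haveI := hε s₀
    exact le_trans (by omega) (le_of_isClosedImmersion_projectiveSpace (hfam.isSmoothProjective s₀) (fiberι f s₀ ≫ ε))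
  -- … and its `K`-SYMMETRISATION `ε_K = Segre ∘ (s_{p-1} ∘ ε, ε ∘ g)`: hyperplane class `p·ε^*g + g^*ε^*g`
  obtain ⟨gS, hgr, hgnz, hgσ⟩ := Motives.exists_segreHyperplaneClasses
  obtain ⟨M, hM⟩ : ∃ M : ℕ, M = ProjectiveSpace.segrePowDim mN (p - 1) * mN + ProjectiveSpace.segrePowDim mN (p - 1) + mN :=
    ⟨_, rfl⟩
  obtain ⟨εK, hεKdef⟩ : ∃ εK : 𝒳 ⟶ projectiveSpace M ℂ, εK = hM ▸ (CartesianMonoidalCategory.lift (𝟙 𝒳) g ≫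
      ((ε ≫ ProjectiveSpace.segrePow mN ℂ (p - 1)) ⊗ₘ ε) ≫ segreEmbedding (ProjectiveSpace.segrePowDim mN (p - 1)) mN ℂ) :=
    ⟨_, rfl⟩
  subst hM
  have hM1 : 1 ≤ ProjectiveSpace.segrePowDim mN (p - 1) * mN + ProjectiveSpace.segrePowDim mN (p - 1) + mN :=
    le_trans hmN (Nat.le_add_left _ _)
  have hεK : complexBetti.map εK 2 (gS _) =
      (p : ℂ) • complexBetti.map ε 2 (gS mN) + complexBetti.map g 2 (complexBetti.map ε 2 (gS mN)) := by
    rw [hεKdef]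
    change complexBetti.map (CartesianMonoidalCategory.lift (𝟙 𝒳) g ≫
      ((ε ≫ ProjectiveSpace.segrePow mN ℂ (p - 1)) ⊗ₘ ε) ≫ segreEmbedding (ProjectiveSpace.segrePowDim mN (p - 1)) mN ℂ) 2
        (gS _) = _
    rw [SegreHyperplaneClass.map_comp_apply', SegreHyperplaneClass.map_comp_apply', hgσ, map_add, map_add,
      SegreHyperplaneClass.map_tensorHom_map_fst, SegreHyperplaneClass.map_tensorHom_map_snd,
      SegreHyperplaneClass.map_lift_map_fst, SegreHyperplaneClass.map_lift_map_snd, complexBetti.map_id,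
      ModuleCat.id_apply, SegreHyperplaneClass.map_comp_apply',
      SegreHyperplaneClass.map_segrePow_of_additive gS hgσ mN (p - 1), map_smul, Nat.sub_add_cancel hp.one_lt.le]
  -- the `K`-symmetrised morphism is a closed immersion on every fibre
  have hεKt : ∀ t : ComplexPoints S, IsClosedImmersion (fiberι f t ≫ εK).left := by
    intro t
    haveI := hε t
    haveI := SegreHyperplaneClass.isClosedImmersion_segrePow_left mN (p - 1)
    haveI : IsClosedImmersion (fiberι f t ≫ ε ≫ ProjectiveSpace.segrePow mN ℂ (p - 1)).left := by
      rw [← Category.assoc, Over.comp_left]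
      infer_instance
    haveI := SegreHyperplaneClass.isSeparated_projectiveSpace_hom mN
    haveI := SegreHyperplaneClass.isClosedImmersion_lift_id_left (X := fiberOver f t)
      (Y := projectiveSpace mN ℂ) (fiberι f t ≫ g ≫ ε)
    haveI := isClosedImmersion_tensorHom_left (X := fiberOver f t) (Y := projectiveSpace mN ℂ)
      (fiberι f t ≫ ε ≫ ProjectiveSpace.segrePow mN ℂ (p - 1)) (𝟙 (projectiveSpace mN ℂ))
    have heq : fiberι f t ≫ εK = (CartesianMonoidalCategory.lift (𝟙 _) (fiberι f t ≫ g ≫ ε) ≫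
        ((fiberι f t ≫ ε ≫ ProjectiveSpace.segrePow mN ℂ (p - 1)) ⊗ₘ 𝟙 (projectiveSpace mN ℂ))) ≫
        segreEmbedding (ProjectiveSpace.segrePowDim mN (p - 1)) mN ℂ := by
      rw [hεKdef]
      change fiberι f t ≫ CartesianMonoidalCategory.lift (𝟙 𝒳) g ≫
        ((ε ≫ ProjectiveSpace.segrePow mN ℂ (p - 1)) ⊗ₘ ε) ≫ segreEmbedding (ProjectiveSpace.segrePowDim mN (p - 1)) mN ℂ = _
      rw [← Category.assoc, CartesianMonoidalCategory.comp_lift, Category.comp_id, ← Category.assoc,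
        CartesianMonoidalCategory.lift_map, CartesianMonoidalCategory.lift_map, Category.id_comp,
        Category.comp_id]
      simp only [Category.assoc]
    rw [heq, Over.comp_left, Over.comp_left]
    infer_instance
  -- the induced projective embedding of the anchor `Y`, with its `K`-symmetric hyperplane class
  have hcl : IsClosedImmersion (e₀.hom ≫ fiberι f s₀ ≫ εK).left := by
    haveI : IsIso e₀.hom.left := (inferInstance : IsIso ((Over.forget _).mapIso e₀).hom)
    haveI := hεKt s₀
    rw [Over.comp_left]
    infer_instance
  let eY : ProjectiveEmbedding Y.X := ⟨_, e₀.hom ≫ fiberι f s₀ ≫ εK, hcl⟩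
  have hΨp : Ψ ≫ Ψ = -(p • 𝟙 Y) := by rw [hΨ, natCast_zsmul]
  have hKsym : complexBetti.map Ψ.hom.hom.hom 2 (complexBetti.map eY.ι 2 (gS _)) =
      (p : ℂ) • complexBetti.map eY.ι 2 (gS _) := by
    -- `h := e_Y^* g = p·u + Ψ^*u` with `u = (e₀ ≫ ι_{s₀} ≫ ε)^* g_m`
    have hu : complexBetti.map e₀.hom 2 (complexBetti.map (fiberι f s₀) 2
        (complexBetti.map g 2 (complexBetti.map ε 2 (gS mN)))) =
        complexBetti.map Ψ.hom.hom.hom 2 (complexBetti.map (e₀.hom ≫ fiberι f s₀ ≫ ε) 2 (gS mN)) := by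
      rw [← SegreHyperplaneClass.map_comp_apply', ← SegreHyperplaneClass.map_comp_apply',
        ← Category.assoc, he₀g, SegreHyperplaneClass.map_comp_apply', SegreHyperplaneClass.map_comp_apply',
        SegreHyperplaneClass.map_comp_apply', SegreHyperplaneClass.map_comp_apply']
    have hh : complexBetti.map eY.ι 2 (gS _) =
        (p : ℂ) • complexBetti.map (e₀.hom ≫ fiberι f s₀ ≫ ε) 2 (gS mN) +
          complexBetti.map Ψ.hom.hom.hom 2 (complexBetti.map (e₀.hom ≫ fiberι f s₀ ≫ ε) 2 (gS mN)) := by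
      change complexBetti.map (e₀.hom ≫ fiberι f s₀ ≫ εK) 2 (gS _) = _
      rw [SegreHyperplaneClass.map_comp_apply', SegreHyperplaneClass.map_comp_apply', hεK, map_add, map_add,
        map_smul, map_smul, hu, SegreHyperplaneClass.map_comp_apply', SegreHyperplaneClass.map_comp_apply']
    have hcomp : Ψ.hom.hom.hom ≫ Ψ.hom.hom.hom = (Ψ ≫ Ψ).hom.hom.hom := rfl
    rw [hh, map_add, map_smul, ← SegreHyperplaneClass.map_comp_apply' Ψ.hom.hom.hom Ψ.hom.hom.hom, hcomp, hΨp,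
      SegreHyperplaneClass.complexBetti_map_neg_nsmul_id_two, smul_add, smul_smul, pow_two]
    abel
  -- the transported class on the anchor
  set x₀ : complexBetti Y.X (2 * k) :=
    complexBetti.map e₀.hom (2 * k) (complexBetti.map (fiberι f s₀) (2 * k) W) with hx₀def
  have hx₀rat : IsRationalClass x₀ := (hfibre s₀).1.map _
  have hx₀H : IsOfHodgeType (2 * k) Y.X (2 * k) k k x₀ := by
    have h := (hfibre s₀).2.map_of_iso e₀
    exact h
  -- the SUPPLY: the clean, charged, semiregular integral lci, produced INSIDE the fibre `𝒳_{s₀}` (copy `e₀`)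
  obtain ⟨Z, i, θ, α, hci, hlci, hint, hcoh, hcohp, hsr, hθ, hα, hsupp⟩ :=
    hS Y Ψ hY hΨ htensor eY (gS _) (hgr _) (hgnz _ hM1) hKsym x₀ hx₀ hx₀ne hx₀rat hx₀H (fiberOver f s₀) e₀
  -- the corrected global class
  set W' : complexBetti 𝒳 (2 * k) := (α : ℂ) • W + complexBetti.map εK (2 * k) θ with hW'def
  have hW's : ∀ s : ComplexPoints S, complexBetti.map (fiberι f s) (2 * k) W' =
      (α : ℂ) • complexBetti.map (fiberι f s) (2 * k) W + complexBetti.map (fiberι f s ≫ εK) (2 * k) θ := by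
    intro s
    rw [hW'def, map_add, map_smul, complexBetti.map_comp, CategoryTheory.comp_apply]
  have halgθ : ∀ s : ComplexPoints S,
      complexBetti.map (fiberι f s ≫ εK) (2 * k) θ ∈ algebraicClasses (fiberOver f s) k := fun s ↦
    map_projectiveSpace_mem_algebraicClasses (hfam.isSmoothProjective s) (fiberι f s ≫ εK) k θ
  have hfibre' : ∀ s : ComplexPoints S, IsRationalClass (complexBetti.map (fiberι f s) (2 * k) W') ∧
      IsOfHodgeType (2 * k) (fiberOver f s) (2 * k) k k (complexBetti.map (fiberι f s) (2 * k) W') := by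
    intro s
    rw [hW's s]
    refine ⟨((hfibre s).1.smul α).add (hθ.map _), ?_⟩
    have hH1 : IsOfHodgeType (2 * k) (fiberOver f s) (2 * k) k k
        ((α : ℂ) • complexBetti.map (fiberι f s) (2 * k) W) := ((hfibre s).2.smul (α : ℂ))
    have hH2 : IsOfHodgeType (2 * k) (fiberOver f s) (2 * k) k k (complexBetti.map (fiberι f s ≫ εK) (2 * k) θ) :=
      isOfHodgeType_of_mem_algebraicClasses_of_isSmoothProjective (hfam.isSmoothProjective s) k (halgθ s)
    exact hH1.add (hfam.isSmoothProjective s) hH2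
  -- on the anchor `W'` restricts, through `e₀`, to the class carried by `Z`
  have hxW' : complexBetti.map e₀.hom (2 * k) (complexBetti.map (fiberι f s₀) (2 * k) W') =
      (α : ℂ) • x₀ + complexBetti.map eY.ι (2 * k) θ := by
    rw [hW's s₀, map_add, map_smul, ← hx₀def]
    congr 1
    change _ = complexBetti.map (e₀.hom ≫ fiberι f s₀ ≫ εK) (2 * k) θ
    simp only [complexBetti.map_comp, CategoryTheory.comp_apply]
  -- … i.e. `W'|_{𝒳_{s₀}} = e₀^{-1 *}(α • x₀ + e_Y^*θ)` is supported on `Z`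
  have hsupp' : complexBetti.map (fiberι f s₀) (2 * k) W' ∈
      classesSupportedOn (fiberOver f s₀) (Set.range i.base) (2 * k) := by
    have hback : complexBetti.map e₀.inv (2 * k)
        (complexBetti.map e₀.hom (2 * k) (complexBetti.map (fiberι f s₀) (2 * k) W')) =
          complexBetti.map (fiberι f s₀) (2 * k) W' := by
      rw [← CategoryTheory.comp_apply, ← complexBetti.map_comp, Iso.inv_hom_id, complexBetti.map_id,
        CategoryTheory.id_apply]
    rw [← hback, hxW']
    exact hsupp
  -- BLOCH LIFTS + FULTON SPECIALISES (through the glue: purity, rigidity of flat sections, open image of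
  -- the étale base change): algebraicity spreads to a neighbourhood of `s₀`
  obtain ⟨U, hUo, hs₀U, hU⟩ := semiregularSpread_of_blochLifts_of_fulton hBl hFu f (2 * k) k hfam hemb hsm s₀ Z i
    hci hlci hint hcoh hcohp hsr W' (fun s ↦ (hfibre' s).2) hsupp'
  -- Baire (algebraicity-locus structure theorem, proved in the tree): algebraic at every fibre
  have hall := forall_mem_algebraicClasses_of_isOpen_nonempty f hfam h𝒳qp hSqp hsm hirr W' hUo ⟨s₀, hs₀U⟩ hU
  -- at `s₁`: subtract the linear-section class and divide by `α`
  have h₁' : complexBetti.map (fiberι f s₁) (2 * k) W ∈ algebraicClasses (fiberOver f s₁) k := by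
    have h := hall s₁
    rw [hW's s₁] at h
    have hsm' : (α : ℂ) • complexBetti.map (fiberι f s₁) (2 * k) W ∈ algebraicClasses (fiberOver f s₁) k :=
      (Submodule.add_mem_iff_left _ (halgθ s₁)).1 h
    have hα' : (α : ℂ) ≠ 0 := by exact_mod_cast hα
    have h2 := Submodule.smul_mem _ ((α : ℂ)⁻¹) hsm'
    rwa [smul_smul, inv_mul_cancel₀ hα', one_smul] at h2
  -- return along `e : A ≅ 𝒳_{s₁}`
  have key := mem_algebraicClasses_map_of_iso (p := k) (hfam.isSmoothProjective s₁)
    (AbelianVariety.isSmoothProjective_holds (A := A)) e h₁'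
  rw [hW₁, ← CategoryTheory.comp_apply, ← complexBetti.map_comp, Iso.hom_inv_id,
    complexBetti.map_id] at key
  exact key



end Summit.HodgeConjecture.HodgeConjecture.Theorems.HeckePrymWeilLine

end
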